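import Summits.Ventures.PercRepro0.ContinuityCoupling

/-! # F4(iii) in Lean: a uniform bound on the triangle sum below `p` transfers to `p` (p5)

The H1 «transfer clause» of ROUTE-v3/v4 (used only if a print states the triangle bound uniformly for `q < p_c`
rather than at `p_c`): if the triangle sums `Σ_{x,y} τ_q(0,x) τ_q(x,y) τ_q(y,0)` are bounded by `K` for all `q < p`,
then the family at `p` is summable with sum `≤ K` — by left-continuity of `τ` (`continuousWithinAt_tau_Iio`) on each
finite partial sum and `summable_of_sum_le`. Stated with the clamped two-point function on `ℝ`.
-/

namespace Summit.Ventures.PercRepro0.Defs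

open MeasureTheory ProbabilityTheory unitInterval Set Filter Topology

variable {d : ℕ}

/-- The triangle summand at parameter `r ∈ ℝ` (clamped). -/
noncomputable def triangleTerm (d : ℕ) (r : ℝ) (xy : Vertex d × Vertex d) : ℝ :=
  tau d (clamp r) 0 xy.1 * tau d (clamp r) xy.1 xy.2 * tau d (clamp r) xy.2 0

/-- Each triangle summand is non-negative. -/
theorem triangleTerm_nonneg (r : ℝ) (xy : Vertex d × Vertex d) : 0 ≤ triangleTerm d r xy :=
  mul_nonneg (mul_nonneg ENNReal.toReal_nonneg ENNReal.toReal_nonneg) ENNReal.toReal_nonneg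

/-- Each triangle summand is left-continuous in the parameter. -/
theorem continuousWithinAt_triangleTerm_Iio (xy : Vertex d × Vertex d) (p : ℝ) :
    ContinuousWithinAt (fun r => triangleTerm d r xy) (Set.Iio p) p :=
  ((continuousWithinAt_tau_Iio 0 xy.1 p).mul (continuousWithinAt_tau_Iio xy.1 xy.2 p)).mul
    (continuousWithinAt_tau_Iio xy.2 0 p)

/-- F4(iii): a bound `K` on all finite partial triangle sums for every `q < p` gives summability at `p` with sum `≤ K`.
In particular `TriangleCondition d (clamp p)`. -/
theorem triangle_of_uniform_bound (p : ℝ) (K : ℝ)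
    (hK : ∀ q : ℝ, q < p → ∀ s : Finset (Vertex d × Vertex d), ∑ xy ∈ s, triangleTerm d q xy ≤ K) :
    Summable (triangleTerm d p) ∧ ∑' xy, triangleTerm d p xy ≤ K := by
  have hfin : ∀ s : Finset (Vertex d × Vertex d), ∑ xy ∈ s, triangleTerm d p xy ≤ K := by
    intro s
    have hcont : Tendsto (fun r => ∑ xy ∈ s, triangleTerm d r xy) (𝓝[<] p)
        (𝓝 (∑ xy ∈ s, triangleTerm d p xy)) :=
      tendsto_finsetSum s fun xy _ => (continuousWithinAt_triangleTerm_Iio xy p).tendsto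
    refine le_of_tendsto hcont ?_
    exact Filter.eventually_of_mem self_mem_nhdsWithin fun q hq => hK q hq s
  have hsum : Summable (triangleTerm d p) :=
    summable_of_sum_le (fun xy => triangleTerm_nonneg p xy) hfin
  exact ⟨hsum, hsum.tsum_le_of_sum_le hfin⟩

/-- The triangle condition at `p` (clamped) follows from the uniform bound below `p`. -/
theorem triangleCondition_of_uniform_bound (p : ℝ) (K : ℝ)
    (hK : ∀ q : ℝ, q < p → ∀ s : Finset (Vertex d × Vertex d), ∑ xy ∈ s, triangleTerm d q xy ≤ K) :
    TriangleCondition d (clamp p) :=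
  (triangle_of_uniform_bound p K hK).1

end Summit.Ventures.PercRepro0.Defs
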